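import Summits.Ventures.HodgeRepro2.T5SU11KernelDifferenceTwoSidedGlobal
import Summits.Ventures.HodgeRepro2.T5SU11ResolventKernelComposition

/-!
# The difference of two resolvents on `L¹(Ξ sinh 2s ds)`: `|G^I_λ g(t) − G^I_{λ₂} g(t)| ≤ C Ξ(t) ∫ Ξ |g| sinh 2s ds`

Row 650's global bound `|K_λ − K_{λ₂}| ≤ C Ξ ⊗ Ξ` in the kernel representations of the two resolvents gives, for every source
integrable against both bases — bounded or not —

* `abs_greenSolI_sub_le_mul_sph_one_integral` — **`|G^I_λ g(t) − G^I_{λ₂} g(t)| ≤ C Ξ(t) ∫_0^∞ Ξ(s) |g(s)| sinh 2s ds`** for every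
  `t > 0` and `|μ − μ₂| < (λ₂ − 1)²`: the difference of two resolvents maps the `Ξ`-weighted `L¹` class into `Ξ · L^∞`, with no
  boundedness of the source required (rows 5xx had the bound on the weighted space `W_1 = {|g| ≤ D Ξ}`).

Nothing is claimed about (N).

Blind lane: Mathlib + the HodgeRepro2 prefix only; no sorry; axioms ⊆ {propext, Classical.choice,
Quot.sound}.
-/

namespace Summit.Ventures.HodgeRepro2.T5SU11ResolventDifferenceWeightedL1

open Filter Topology MeasureTheory
open Set (Ioi Ioc)
open T5SU11Cartan T5SU11SphericalFunction T5SU11SphericalBounds T5SU11SphericalDecay T5SU11ReductionOfOrder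
  T5SU11RadialGreenKernel T5SU11RadialGreenImproper T5SU11ResolventKernelComposition T5SU11ResolventTransformClass
  T5SU11KernelDifferenceTwoSidedGlobal

section measure

variable [MeasurableSpace Circle] [BorelSpace Circle]

variable {lam lam₂ : ℝ} (hlam : 1 < lam) (hlam₂ : 1 < lam₂)

include hlam hlam₂ in
/-- **`|G^I_λ g(t) − G^I_{λ₂} g(t)| ≤ C Ξ(t) ∫_0^∞ Ξ |g| sinh 2s ds`** for `|μ − μ₂| < (λ₂ − 1)²`, `t > 0`, and every source `g`
integrable against both bases. -/
theorem abs_greenSolI_sub_le_mul_sph_one_integral (hq : |lam * (lam - 2) - lam₂ * (lam₂ - 2)| < (lam₂ - 1) ^ 2) :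
    ∃ C : ℝ, 0 < C ∧ ∀ g : ℝ → ℝ,
      (∀ T, IntegrableOn (fun s => sph lam (hyp s) * g s * Real.sinh (2 * s)) (Ioc 0 T)) →
      IntegrableOn (fun s => sphDecay lam s * g s * Real.sinh (2 * s)) (Ioi 0) →
      (∀ T, IntegrableOn (fun s => sph lam₂ (hyp s) * g s * Real.sinh (2 * s)) (Ioc 0 T)) →
      IntegrableOn (fun s => sphDecay lam₂ s * g s * Real.sinh (2 * s)) (Ioi 0) →
      IntegrableOn (fun s => sph 1 (hyp s) * |g s| * Real.sinh (2 * s)) (Ioi 0) →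
      ∀ t, 0 < t →
      |greenSolI (fun t => sph lam (hyp t)) (sphDecay lam) g t - greenSolI (fun t => sph lam₂ (hyp t)) (sphDecay lam₂) g t|
        ≤ C * sph 1 (hyp t) * ∫ s in Ioi 0, sph 1 (hyp s) * |g s| * Real.sinh (2 * s) := by
  obtain ⟨C, hC, hC'⟩ := exists_abs_kernel_sub_le_mul_sph_one hlam hlam₂ hq
  refine ⟨C, hC, fun g hB hA hB₂ hA₂ hΞ t ht => ?_⟩
  rw [greenSolI_eq_integral_kernel hB hA ht, greenSolI_eq_integral_kernel hB₂ hA₂ ht]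
  have h1 := integrableOn_kernel_mul hB hA ht
  have h2 := integrableOn_kernel_mul hB₂ hA₂ ht
  change IntegrableOn (fun s => sphGreenKernel lam t s * g s * Real.sinh (2 * s)) (Ioi 0) at h1
  change IntegrableOn (fun s => sphGreenKernel lam₂ t s * g s * Real.sinh (2 * s)) (Ioi 0) at h2
  change |(∫ s in Ioi 0, sphGreenKernel lam t s * g s * Real.sinh (2 * s))
    - ∫ s in Ioi 0, sphGreenKernel lam₂ t s * g s * Real.sinh (2 * s)| ≤ _
  rw [← integral_sub h1 h2]
  have hΞt : 0 < sph 1 (hyp t) := sph_hyp_pos 1 t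
  have hmaj := hΞ.const_mul (C * sph 1 (hyp t))
  calc |∫ s in Ioi 0, (sphGreenKernel lam t s * g s * Real.sinh (2 * s)
        - sphGreenKernel lam₂ t s * g s * Real.sinh (2 * s))|
      ≤ ∫ s in Ioi 0, |sphGreenKernel lam t s * g s * Real.sinh (2 * s)
        - sphGreenKernel lam₂ t s * g s * Real.sinh (2 * s)| := abs_integral_le_integral_abs
    _ ≤ ∫ s in Ioi 0, C * sph 1 (hyp t) * (sph 1 (hyp s) * |g s| * Real.sinh (2 * s)) := by
        refine setIntegral_mono_on (h1.sub h2).abs hmaj measurableSet_Ioi fun s hs => ?_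
        have hs' : (0 : ℝ) < s := hs
        have hK := hC' t s ht hs'
        have hsh : 0 ≤ Real.sinh (2 * s) := (sinh_two_mul_pos hs').le
        have hΞs : 0 < sph 1 (hyp s) := sph_hyp_pos 1 s
        have e : sphGreenKernel lam t s * g s * Real.sinh (2 * s) - sphGreenKernel lam₂ t s * g s * Real.sinh (2 * s)
            = (sphGreenKernel lam t s - sphGreenKernel lam₂ t s) * g s * Real.sinh (2 * s) := by ring
        rw [e, abs_mul, abs_mul, abs_of_nonneg hsh]
        have h0 : 0 ≤ |g s| * Real.sinh (2 * s) := mul_nonneg (abs_nonneg _) hsh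
        calc |sphGreenKernel lam t s - sphGreenKernel lam₂ t s| * |g s| * Real.sinh (2 * s)
            ≤ C * sph 1 (hyp t) * sph 1 (hyp s) * |g s| * Real.sinh (2 * s) := by
              have := mul_le_mul_of_nonneg_right hK h0
              nlinarith [this]
          _ = C * sph 1 (hyp t) * (sph 1 (hyp s) * |g s| * Real.sinh (2 * s)) := by ring
    _ = C * sph 1 (hyp t) * ∫ s in Ioi 0, sph 1 (hyp s) * |g s| * Real.sinh (2 * s) := by
        rw [MeasureTheory.integral_const_mul]

end measure

end Summit.Ventures.HodgeRepro2.T5SU11ResolventDifferenceWeightedL1
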